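import Mathlib
import Literature.Analysis.FluidPDE.VectorCalculus
import Literature.Analysis.FluidPDE.PolynomialFieldCertificates
import Summits.NavierStokesRegularity.NavierStokesRegularity.Theorems.ThreadingFluxAzimuthalCartanDefs
import Summits.NavierStokesRegularity.NavierStokesRegularity.Theorems.ThreadingFluxAzimuthalCartanPoiseuilleBase
import Summits.NavierStokesRegularity.NavierStokesRegularity.Theorems.ThreadingFluxAzimuthalCartanPoiseuilleJordanCalculus
import HarnessLib

/-!
# Crux `PoloidalLiouville` (stmt-NavierStokesRegularity-1222, wall W1), crux idea «azimuthal-cartan-test» (ns-idea-15 g10,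
# `Cruxes/PoloidalLiouville/AzimuthalCartanSketch.lean` v1.3c): J♭ `PoiseuilleJordanMode` BY NAME, and
# `¬ InfinitesimalRigidityOffCentreBall` — BALL-LOCAL LINEARISED UNTHREADED RIGIDITY IS FALSE

Support file (Theorems-side; seat ns-wall-eng-6 g4, cell `ns-wall-extremal`, W1 adjunct; `--supports stmt-NavierStokesRegularity-1222
--as helper`; 0 kit).  Second J♭ file (critic V26-P1 / V26-R: the `φ`-linear Jordan mode, made elementary at the Poiseuille base by the
custodian's v1.3):

* `Jordan.laplacian_Jf_zero/one/two` — `ΔJ = 2ℓ e₂` on `H` (second derivatives of the explicit first-derivative formulas; the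
  horizontal components are conjugate-harmonic combinations, `Δ J₀ = Δ J₁ = 0`);
* `Jordan.linearisedSteadyNSOn_Jf` — the LINEARISED steady Navier–Stokes system at `poiseuille` with `δp = 0` on `ball xTest 1`
  (`DJ·V = 0`, `DV·J = 2ℓ e₂ = ΔJ`, `div J = 0`);
* `Jordan.tilt_poiseuille_eq` — `tilt poiseuille 0 Ω` is the polynomial field `(−qΩ₁, qΩ₀, 2x₂(x₀Ω₁ − x₁Ω₀))`;
  `Jordan.cube_mul_eq_one_of_equivariantAt` — `J₃`-equivariance of `jordanMode − tilt poiseuille 0 Ω` at `(a, 0, 4)` forces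
  `a³Ω₁ = 1` (the `J₃`-Lie derivative of the Jordan mode there is `e_φ/ρ = (0, 1/a, 0)`; `log` cancels); comparing `a = 3` and
  `a = 7/2` ⇒ `Jordan.not_exists_tilt_equivariant`;
* ★★ `AzimuthalCartan.poiseuilleJordanMode : PoiseuilleJordanMode` (sketch l.278, Defs twin verbatim) and
  ★★★ `AzimuthalCartan.not_infinitesimalRigidityOffCentreBall : ¬ InfinitesimalRigidityOffCentreBall` (sketch l.266; the sketch's
  glue `ballRigidity_refuted` re-derived over the twin with the kernel inputs J♭ + L′ `poiseuilleBaseFacts`).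

HONEST LABEL: a NEGATIVE kernel fact about the BALL-LOCAL, LINEARISED, off-centre form of unthreaded steady rigidity (the v1.0/v1.1 typing
I♭ on balls) — it is FALSE already at the simplest axisymmetric base; it says nothing against I♭ on solid tori, C♯ on shells,
`PoloidalLiouville` (1222), its steady stratum or NS regularity (all OPEN); information-grade for the W1 record (critic V26-R2 words:
«ball-local steady unthreaded rigidity off the centre is false; periodicity in φ is load-bearing»).
[cite: MajdaBertozziCUP2002, §1.1 (vector identities)]
-/

-- the summit and its single problem share the name (D-0017 nested layout)
set_option linter.dupNamespace false

noncomputable section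

open Set Function Filter Metric
open scoped RealInnerProductSpace Topology
open Literature.Analysis.FluidPDE Literature.Analysis.Calculus.MvPoly Literature.Analysis.FluidPDE.PolyFieldCert
open Summit.NavierStokesRegularity.NavierStokesRegularity.Theorems.PoloidalLiouville.CentreJet (E3 IsUnthreadedAbout IsSteadyNSOn)

namespace Summit.NavierStokesRegularity.NavierStokesRegularity.Theorems.PoloidalLiouville.AzimuthalCartan

namespace Jordan

/-! ### The Laplacian: components -/

open scoped Laplacian in
/-- Components of the Laplacian of the Jordan mode are the Laplacians of its components (on `H`). -/
theorem laplacian_Jf_apply {x : E3} (hx : x ∈ H) (i : Fin 3) :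
    (Δ Jf) x i = (Δ (fun y => Jf y i)) x := by
  have h : (fun y => Jf y i) = (EuclideanSpace.proj i : E3 →L[ℝ] ℝ) ∘ Jf := rfl
  rw [h, ContDiffAt.laplacian_CLM_comp_left (contDiffAt_Jf hx)]
  rfl

/-- `J e₀`-component. -/
theorem Jf_apply_zero (y : E3) : Jf y 0 = J0 y := by simp [Jf, e]
/-- `J e₁`-component. -/
theorem Jf_apply_one (y : E3) : Jf y 1 = J1 y := by simp [Jf, e]
/-- `J e₂`-component. -/
theorem Jf_apply_two (y : E3) : Jf y 2 = J2 y := by simp [Jf, e]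

open scoped Laplacian in
/-- Laplacian of a scalar from an explicit `C¹` formula for its derivative near the point:
if `Df = G` near `x` and `G` has derivative `G'` at `x`, then `Δ f (x) = Σᵢ G' eᵢ eᵢ`. -/
theorem laplacian_eq_of_fderiv_eq {f : E3 → ℝ} {G : E3 → E3 →L[ℝ] ℝ} {G' : E3 →L[ℝ] E3 →L[ℝ] ℝ} {x : E3}
    (hfG : fderiv ℝ f =ᶠ[𝓝 x] G) (hG : HasFDerivAt G G' x) :
    (Δ f) x = ∑ i : Fin 3, G' (e i) (e i) := by
  rw [InnerProductSpace.laplacian_eq_iteratedFDeriv_orthonormalBasis f (EuclideanSpace.basisFun (Fin 3) ℝ)]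
  simp only [iteratedFDeriv_two_apply, EuclideanSpace.basisFun_apply, Matrix.cons_val_zero, Matrix.cons_val_one]
  rw [hfG.fderiv_eq, hG.fderiv]

/-- Near a point of `H`, `DJ₂ = (x₀ C) dx₀ + (x₁ C) dx₁`. -/
theorem fderiv_J2_eventuallyEq {x : E3} (hx : x ∈ H) :
    fderiv ℝ J2 =ᶠ[𝓝 x] fun y => (y 0 * C y) • dx 0 + (y 1 * C y) • dx 1 := by
  filter_upwards [isOpen_H.mem_nhds hx] with y hy using (hasFDerivAt_J2 hy).fderiv

/-- `DC = Dℓ`. -/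
theorem hasFDerivAt_C {x : E3} (hx : x ∈ H) : HasFDerivAt C ((x 0 / q x) • dx 0 + (x 1 / q x) • dx 1) x :=
  (hasFDerivAt_ell hx).sub_const _

open scoped Laplacian in
/-- `Δ J₂ = 2ℓ` on `H`. -/
theorem laplacian_J2 {x : E3} (hx : x ∈ H) : (Δ J2) x = 2 * ell x := by
  have hq := (q_pos hx).ne'
  have hG := (((hasFDerivAt_coord 0 x).fun_mul (hasFDerivAt_C hx)).smul_const (dx 0)).add
      (((hasFDerivAt_coord 1 x).fun_mul (hasFDerivAt_C hx)).smul_const (dx 1))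
  rw [laplacian_eq_of_fderiv_eq (fderiv_J2_eventuallyEq hx) hG]
  simp only [Fin.sum_univ_three, _root_.add_apply, ContinuousLinearMap.smulRight_apply, _root_.smul_apply, dx_apply,
    smul_eq_mul, e, C]
  simp [q] at hq ⊢
  field_simp
  ring

/-- `D(1/q²) = −2 Dq/q³` on `H`. -/
theorem hasFDerivAt_inv_q_sq {x : E3} (hx : x ∈ H) :
    HasFDerivAt (fun y => (q y ^ 2)⁻¹) ((-(4 * x 0) / q x ^ 3) • dx 0 + (-(4 * x 1) / q x ^ 3) • dx 1) x := by
  have hq := (q_pos hx).ne'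
  have hq2 : q x ^ 2 ≠ 0 := pow_ne_zero 2 hq
  refine ((hasDerivAt_inv hq2).comp_hasFDerivAt x ((hasFDerivAt_q x).pow 2)).congr_fderiv ?_
  ext v
  simp only [_root_.add_apply, _root_.smul_apply, dx_apply, smul_eq_mul, Nat.add_one_sub_one, pow_one]
  field_simp
  ring

/-- Near a point of `H`, `DJ₀ = A dx₀ + B dx₁`. -/
theorem fderiv_J0_eventuallyEq {x : E3} (hx : x ∈ H) :
    fderiv ℝ J0 =ᶠ[𝓝 x] fun y => A y • dx 0 + B y • dx 1 := by
  filter_upwards [isOpen_H.mem_nhds hx] with y hy using (hasFDerivAt_J0 hy).fderiv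

/-- Near a point of `H`, `DJ₁ = B dx₀ − A dx₁`. -/
theorem fderiv_J1_eventuallyEq {x : E3} (hx : x ∈ H) :
    fderiv ℝ J1 =ᶠ[𝓝 x] fun y => B y • dx 0 + (-(A y)) • dx 1 := by
  filter_upwards [isOpen_H.mem_nhds hx] with y hy using (hasFDerivAt_J1 hy).fderiv

open scoped Laplacian in
/-- `Δ J₀ = 0` on `H` (`J₀ = ½ ∂₀(φ² − ℓ²)` with `φ`, `ℓ` conjugate harmonic). -/
theorem laplacian_J0 {x : E3} (hx : x ∈ H) : (Δ J0) x = 0 := by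
  have hq := (q_pos hx).ne'
  -- derivatives of the numerators of `A` and `B`
  have hNA := ((((hasFDerivAt_coord 1 x).pow 2).sub ((hasFDerivAt_coord 0 x).pow 2)).add
      ((((hasFDerivAt_coord 0 x).pow 2).sub ((hasFDerivAt_coord 1 x).pow 2)).fun_mul (hasFDerivAt_ell hx))).add
    ((((hasFDerivAt_coord 0 x).const_mul (2 : ℝ)).fun_mul (hasFDerivAt_coord 1 x)).fun_mul (hasFDerivAt_phi hx))
  have hNB := ((((hasFDerivAt_coord 0 x).const_mul (2 : ℝ)).fun_mul (hasFDerivAt_coord 1 x)).neg.add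
      ((((hasFDerivAt_coord 0 x).const_mul (2 : ℝ)).fun_mul (hasFDerivAt_coord 1 x)).fun_mul (hasFDerivAt_ell hx))).add
    ((((hasFDerivAt_coord 1 x).pow 2).sub ((hasFDerivAt_coord 0 x).pow 2)).fun_mul (hasFDerivAt_phi hx))
  have hA' := hNA.fun_mul (hasFDerivAt_inv_q_sq hx)
  have hB' := hNB.fun_mul (hasFDerivAt_inv_q_sq hx)
  have hA : HasFDerivAt A _ x := hA'.congr_of_eventuallyEq (Filter.Eventually.of_forall fun y => by
    simp only [A, Pi.add_apply, Pi.sub_apply, div_eq_mul_inv])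
  have hB : HasFDerivAt B _ x := hB'.congr_of_eventuallyEq (Filter.Eventually.of_forall fun y => by
    simp only [B, Pi.add_apply, Pi.sub_apply, Pi.neg_apply, div_eq_mul_inv])
  have hG := (hA.smul_const (dx 0)).add (hB.smul_const (dx 1))
  rw [laplacian_eq_of_fderiv_eq (fderiv_J0_eventuallyEq hx) hG]
  simp only [Fin.sum_univ_three, _root_.add_apply, _root_.sub_apply, _root_.neg_apply, ContinuousLinearMap.smulRight_apply,
    _root_.smul_apply, dx_apply, smul_eq_mul, e]
  simp [q] at hq ⊢
  field_simp
  ring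

open scoped Laplacian in
/-- `Δ J₁ = 0` on `H`. -/
theorem laplacian_J1 {x : E3} (hx : x ∈ H) : (Δ J1) x = 0 := by
  have hq := (q_pos hx).ne'
  have hNA := ((((hasFDerivAt_coord 1 x).pow 2).sub ((hasFDerivAt_coord 0 x).pow 2)).add
      ((((hasFDerivAt_coord 0 x).pow 2).sub ((hasFDerivAt_coord 1 x).pow 2)).fun_mul (hasFDerivAt_ell hx))).add
    ((((hasFDerivAt_coord 0 x).const_mul (2 : ℝ)).fun_mul (hasFDerivAt_coord 1 x)).fun_mul (hasFDerivAt_phi hx))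
  have hNB := ((((hasFDerivAt_coord 0 x).const_mul (2 : ℝ)).fun_mul (hasFDerivAt_coord 1 x)).neg.add
      ((((hasFDerivAt_coord 0 x).const_mul (2 : ℝ)).fun_mul (hasFDerivAt_coord 1 x)).fun_mul (hasFDerivAt_ell hx))).add
    ((((hasFDerivAt_coord 1 x).pow 2).sub ((hasFDerivAt_coord 0 x).pow 2)).fun_mul (hasFDerivAt_phi hx))
  have hA' := hNA.fun_mul (hasFDerivAt_inv_q_sq hx)
  have hB' := hNB.fun_mul (hasFDerivAt_inv_q_sq hx)
  have hA : HasFDerivAt A _ x := hA'.congr_of_eventuallyEq (Filter.Eventually.of_forall fun y => by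
    simp only [A, Pi.add_apply, Pi.sub_apply, div_eq_mul_inv])
  have hB : HasFDerivAt B _ x := hB'.congr_of_eventuallyEq (Filter.Eventually.of_forall fun y => by
    simp only [B, Pi.add_apply, Pi.sub_apply, Pi.neg_apply, div_eq_mul_inv])
  have hG := (hB.smul_const (dx 0)).add (hA.neg.smul_const (dx 1))
  rw [laplacian_eq_of_fderiv_eq (fderiv_J1_eventuallyEq hx) hG]
  simp only [Fin.sum_univ_three, _root_.add_apply, _root_.sub_apply, _root_.neg_apply, ContinuousLinearMap.smulRight_apply,
    _root_.smul_apply, dx_apply, smul_eq_mul, e]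
  simp [q] at hq ⊢
  field_simp
  ring

open scoped Laplacian in
/-- `(Δ J)₀ = 0` on `H`. -/
theorem laplacian_Jf_zero {x : E3} (hx : x ∈ H) : (Δ Jf) x 0 = 0 := by
  rw [laplacian_Jf_apply hx 0, show (fun y => Jf y 0) = J0 from funext Jf_apply_zero, laplacian_J0 hx]

open scoped Laplacian in
/-- `(Δ J)₁ = 0` on `H`. -/
theorem laplacian_Jf_one {x : E3} (hx : x ∈ H) : (Δ Jf) x 1 = 0 := by
  rw [laplacian_Jf_apply hx 1, show (fun y => Jf y 1) = J1 from funext Jf_apply_one, laplacian_J1 hx]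

open scoped Laplacian in
/-- `(Δ J)₂ = 2ℓ` on `H`. -/
theorem laplacian_Jf_two {x : E3} (hx : x ∈ H) : (Δ Jf) x 2 = 2 * ell x := by
  rw [laplacian_Jf_apply hx 2, show (fun y => Jf y 2) = J2 from funext Jf_apply_two, laplacian_J2 hx]

/-! ### The ball `ball xTest 1` lies in the half-space -/

/-- `ball xTest 1 ⊆ H` (`|x₀ − 3| < 1`). -/
theorem ball_subset_H : ball xTest 1 ⊆ H := by
  intro x hx
  have hd : dist x xTest < 1 := mem_ball.1 hx
  have h0 : |x 0 - xTest 0| ≤ dist x xTest := by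
    have h := EuclideanSpace.dist_eq x xTest
    rw [h]
    have hle : (x 0 - xTest 0) ^ 2 ≤ ∑ i, dist (x i) (xTest i) ^ 2 := by
      rw [Fin.sum_univ_three]
      have e0 : dist (x 0) (xTest 0) ^ 2 = (x 0 - xTest 0) ^ 2 := by rw [Real.dist_eq, sq_abs]
      nlinarith [sq_nonneg (dist (x 1) (xTest 1)), sq_nonneg (dist (x 2) (xTest 2)), e0]
    calc |x 0 - xTest 0| = Real.sqrt ((x 0 - xTest 0) ^ 2) := (Real.sqrt_sq_eq_abs _).symm
      _ ≤ Real.sqrt (∑ i, dist (x i) (xTest i) ^ 2) := Real.sqrt_le_sqrt hle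
  have hx3 : xTest 0 = 3 := by simp [xTest]
  rw [hx3] at h0
  have h1 := abs_lt.1 (lt_of_le_of_lt h0 hd)
  show 0 < x 0
  linarith [h1.1]


/-! ### The tilt of the Poiseuille base, and the Jordan mode is not «tilt + equivariant» -/

/-- The tilt polynomials: `tilt poiseuille 0 Ω = (−q Ω₁, q Ω₀, 2x₂(x₀Ω₁ − x₁Ω₀))`. -/
def tiltP (Ω : E3) : Fin 3 → MvPolynomial (Fin 3) ℝ :=
  ![-((MvPolynomial.X 0 ^ 2 + MvPolynomial.X 1 ^ 2) * MvPolynomial.C (Ω 1)),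
    (MvPolynomial.X 0 ^ 2 + MvPolynomial.X 1 ^ 2) * MvPolynomial.C (Ω 0),
    2 * MvPolynomial.X 2 * (MvPolynomial.X 0 * MvPolynomial.C (Ω 1) - MvPolynomial.X 1 * MvPolynomial.C (Ω 0))]

/-- The tilt of the Poiseuille base is the polynomial field of `tiltP`. -/
theorem tilt_poiseuille_eq (Ω : E3) : tilt poiseuille 0 Ω = polyField (tiltP Ω) := by
  funext x; ext i
  fin_cases i <;>
    simp [tilt, cross, crossProduct, Poiseuille.fderiv_poiseuille_apply, poiseuille, tiltP, polyField_apply, toFun_apply] <;> ring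

/-- Partial derivatives of the middle tilt polynomial. -/
theorem pderiv_tiltP_one (Ω : E3) (j : Fin 3) :
    MvPolynomial.pderiv j (tiltP Ω 1) =
      if j = 0 then 2 * MvPolynomial.X 0 * MvPolynomial.C (Ω 0)
      else if j = 1 then 2 * MvPolynomial.X 1 * MvPolynomial.C (Ω 0) else 0 := by
  fin_cases j <;> simp [tiltP, Derivation.leibniz, Derivation.leibniz_pow] <;> ring

/-- The test points `p_a = (a, 0, 4)`. -/
def pA (a : ℝ) : E3 := EuclideanSpace.single 0 a + EuclideanSpace.single 2 4

/-- Coordinates of `p_a`. -/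
theorem pA_apply (a : ℝ) : pA a 0 = a ∧ pA a 1 = 0 ∧ pA a 2 = 4 := by
  refine ⟨?_, ?_, ?_⟩ <;> simp [pA]

/-- `p_a ∈ H` for `a > 0`. -/
theorem pA_mem_H {a : ℝ} (ha : 0 < a) : pA a ∈ H := by
  show 0 < pA a 0; simpa [pA] using ha

/-- `p_a ∈ ball xTest 1` for `|a − 3| < 1`. -/
theorem pA_mem_ball {a : ℝ} (ha : |a - 3| < 1) : pA a ∈ ball xTest 1 := by
  rw [mem_ball, EuclideanSpace.dist_eq]
  have hs : ∑ i, dist (pA a i) (xTest i) ^ 2 = (a - 3) ^ 2 := by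
    rw [Fin.sum_univ_three]
    simp [pA, xTest, Real.dist_eq, sq_abs]
  rw [hs, Real.sqrt_sq_eq_abs]
  exact ha

/-- KEY STEP.  If `jordanMode − tilt poiseuille 0 Ω` is `J₃`-equivariant at the point `p_a` (`a > 0`), then `a³ Ω₁ = 1`
(the `J₃`-Lie derivative of the Jordan mode at `p_a` is `e_φ/ρ = (0, 1/a, 0)`, that of the tilt is `(a²Ω₀, a²Ω₁, ·)`; the
logarithm `ℓ(p_a)` cancels). -/
theorem cube_mul_eq_one_of_equivariantAt {Ω : E3} {a : ℝ} (ha : 0 < a)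
    (h : fderiv ℝ (jordanMode - tilt poiseuille 0 Ω) (pA a) (J3 (pA a - 0)) = J3 ((jordanMode - tilt poiseuille 0 Ω) (pA a))) :
    a ^ 3 * Ω 1 = 1 := by
  have hp : pA a ∈ H := pA_mem_H ha
  obtain ⟨h0, h1, h2⟩ := pA_apply a
  rw [jordanMode_eq_Jf, tilt_poiseuille_eq] at h
  have hT : HasFDerivAt (polyField (tiltP Ω)) (fderiv ℝ (polyField (tiltP Ω)) (pA a)) (pA a) :=
    (((contDiff_polyField (tiltP Ω) (m := 1)).differentiable one_ne_zero) _).hasFDerivAt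
  have hsub : HasFDerivAt (Jf - polyField (tiltP Ω)) (DJ (pA a) - fderiv ℝ (polyField (tiltP Ω)) (pA a)) (pA a) :=
    (hasFDerivAt_Jf hp).sub hT
  rw [hsub.fderiv, sub_zero] at h
  have h' := congrArg (fun v : E3 => v 1) h
  simp only [_root_.sub_apply, PiLp.sub_apply, Pi.sub_apply, Poiseuille.J3_apply, DJ_apply,
    fderiv_polyField_apply, Fin.sum_univ_three, pderiv_tiltP_one, polyField_apply] at h'
  simp [h0, h1, A, J0, phi, q, tiltP, toFun_apply, Jf, e] at h'
  have hq : a ^ 2 ≠ 0 := pow_ne_zero 2 ha.ne'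
  field_simp at h'
  nlinarith [h', ha]

/-- The Jordan mode is NOT a tilt of the base plus a `J₃`-equivariant field on `ball xTest 1`
(compare the points `(3, 0, 4)` and `(7/2, 0, 4)`: `27 Ω₁ = 1` and `(343/8) Ω₁ = 1`). -/
theorem not_exists_tilt_equivariant :
    ¬ ∃ Ω : E3, IsEquivariantOn (ball xTest 1) 0 J3 (jordanMode - tilt poiseuille 0 Ω) := by
  rintro ⟨Ω, hΩ⟩
  have h3 := cube_mul_eq_one_of_equivariantAt (a := 3) (by norm_num) (hΩ _ (pA_mem_ball (by norm_num)))
  have h7 := cube_mul_eq_one_of_equivariantAt (a := 7 / 2) (by norm_num) (hΩ _ (pA_mem_ball (by norm_num)))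
  nlinarith [h3, h7]

/-! ### Assembly -/

/-- The linearised steady Navier–Stokes system at the Poiseuille base holds for the Jordan mode with `δp = 0` on `H`. -/
theorem linearisedSteadyNSOn_Jf : LinearisedSteadyNSOn (ball xTest 1) poiseuille jordanMode 0 := by
  rw [jordanMode_eq_Jf]
  refine ⟨fun x hx => divergence_Jf (ball_subset_H hx), fun x hx => ?_⟩
  have hxH := ball_subset_H hx
  have hq := (q_pos hxH).ne'
  have hg : gradient (0 : E3 → ℝ) x = 0 := by
    simp [gradient, show (0 : E3 → ℝ) = fun _ => (0 : ℝ) from rfl]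
  rw [fderiv_Jf hxH, hg, add_zero]
  ext i
  rw [PiLp.add_apply, Poiseuille.fderiv_poiseuille_apply, DJ_apply]
  fin_cases i
  · simp [poiseuille, laplacian_Jf_zero hxH]
  · simp [poiseuille, laplacian_Jf_one hxH]
  · simp [poiseuille, laplacian_Jf_two hxH, Jf, e, J0, J1]
    simp only [q] at hq ⊢
    field_simp
    ring

end Jordan

/-- ★★ **J♭ `PoiseuilleJordanMode` BY NAME** (sketch v1.3c l.278, Defs twin verbatim): the explicit `φ`-linear mode `jordanMode`
at the Hagen–Poiseuille base on `ball xTest 1` is analytic, solves the linearised steady Navier–Stokes system with `δp = 0`, is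
unthreaded about `0`, and is NOT a tilt of the base plus a `J₃`-equivariant field. -/
theorem poiseuilleJordanMode : PoiseuilleJordanMode := by
  refine ⟨fun x hx => ?_, Jordan.linearisedSteadyNSOn_Jf, fun x hx => ?_, Jordan.not_exists_tilt_equivariant⟩
  · rw [Jordan.jordanMode_eq_Jf]; exact Jordan.analyticAt_Jf (Jordan.ball_subset_H hx)
  · rw [Jordan.jordanMode_eq_Jf]; exact Jordan.inner_curl_Jf (Jordan.ball_subset_H hx)

/-- ★★★ **`¬ InfinitesimalRigidityOffCentreBall`** (sketch v1.3c l.266; = the sketch's glue `ballRigidity_refuted` fed with the two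
kernel inputs `poiseuilleJordanMode` (J♭) and `poiseuilleBaseFacts` (L′), re-derived here because crux workfiles are not importable):
BALL-LOCAL LINEARISED UNTHREADED RIGIDITY OFF THE CENTRE IS FALSE — at the Hagen–Poiseuille base the linearised steady system on
`ball xTest 1` has an analytic unthreaded solution (the `φ`-linear Jordan mode) that is not a tilt plus an equivariant field. -/
theorem not_infinitesimalRigidityOffCentreBall : ¬ InfinitesimalRigidityOffCentreBall := by
  intro hI
  obtain ⟨h₁, h₂, h₃, h₄⟩ := poiseuilleJordanMode
  obtain ⟨hB, hdeg⟩ := poiseuilleBaseFacts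
  have h0 : AnalyticOnNhd ℝ (0 : E3 → ℝ) (ball xTest 1) := analyticOnNhd_const
  exact h₄ (hI poiseuille poiseuillePressure e3 0 xTest 1 one_pos hB hdeg jordanMode 0 h₁ h0 h₂ h₃)

end Summit.NavierStokesRegularity.NavierStokesRegularity.Theorems.PoloidalLiouville.AzimuthalCartan

end
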